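import Summits.QuantumFields.YangMills.Theorems.FluctuationComparisonRegPrIntLWregChartChargeParam
import HarnessLib

/-!
# `FluctuationComparisonRegPrIntLWregChartChargeOneStep` — THE ONE-BOND (0.4) AVERAGE IS AN OPEN MAP JOINTLY IN (ENVIRONMENT, PIVOT) AT EVERY CENTRAL-WINDOW POINT
# (File 2 of the Theorems-side twin of CHARGE `ChartCharge`, LINE g18-2 `Cruxes/FluctuationComparisonRegPrIntL/Lines/wreg_chart.lean`, organ WREG of crux stmt-QuantumFields-20520)

Cell `ym3-torus` (HUMAN RULING D-0037: YM₃ on T³ is ladder rung R3 — NOT d = 4, NOT infinite volume, NOT a mass gap, NOT the Clay problem); width seat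
`ym-ust-20520-w3` gen 13; `--supports stmt-QuantumFields-20520 --as helper` (count-neutral).  THEOREMS ONLY (0 `def`, 0 `sorry`, default heartbeats).
LINE OWNER word: ideator ym-r3-idea-1 g18 «CHARGE → w3-20520 g13: GO» (ym3-torus STATUS 2026-08-29T14:51:43Z); ★★OWNER ym3-torus-plan g31 WORD 26 (B).

WHAT IS PROVED (generic `(P, j, N)`, `𝓔 = expMeanLogSU (Fin N)` = the printed average):
* §4 the W-coordinate edition: the environment letters are continuous (`continuous_openHolFamily_coe`, `continuous_fibreFamily₂`), the joint guard is open
  (`isOpen_fibreGuard₂`), the fibre map `(U, W) ↦ E_U(W)` is jointly continuous at guard points (`continuousAt_fibreMap₂_of_fibreSmall`, `continuousAt_fibreMap_env_of_fibreSmall`)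
  and reads through the chart model jointly near `(U₀, 0)` (`eventually_fibreMap_mul_expChart_eq₂`); hence ★★★`map_nhds_fibreMap₂_eq_of_mem_centralWindow`:
  `map (U,W) ↦ (U, E_U W) (𝓝 (U₀, W₁)) = 𝓝 (U₀, E_{U₀} W₁)` at every `W₁` of `U₀`'s closed central `α`-window (File 1's joint model step pulled back along `U ↦ (V(U), ↑W₁)`,
  then the parametric chart transport);
* §5 the pivot edition ★★★`map_nhds_oneVariable₂_eq_of_mem_centralWindow`: `map (U,g) ↦ (U, Ū(U[β c ↦ g])(c)) (𝓝 (U₀, g₀)) = 𝓝 (U₀, Ū(U₀[β c ↦ g₀])(c))` for `g₀` in the closed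
  central `α`-window (`j+1 ≤ m+K`, `α ≤ 1∕24`, `α < δ_N`, `157·α < L^{−(d−1)}`) — via ✓`avgFun_update_centralBond_self` and the parametric bi-translation `map_nhds_preMulPost`.
The fixed-environment statement is dag-n09-w6 g4's ✓`map_nhds_oneVariable_eq_of_mem_centralWindow`; the environment is carried here as a parameter (this is what the chain
induction of CHARGE consumes: a MOVING target and a MOVING environment).

HONEST FRAMING.  Count-neutral inverse-function-theorem bookkeeping BY NAME on the pub-ymgap N09 chart model; nothing of Bałaban's estimates asserted; CHARGE ∕ WREG ∕ S2β ∕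
the crux stmt-QuantumFields-20520 are NOT proved here; no summit statement is proved; YM₃ on T³ = rung R3, NOT d = 4, NOT infinite volume, NOT a mass gap, NOT Clay; the YM
mass gap is NOT proved.

References: [Balaban1985Averaging] Prop. 3 (124) p.36; [Balaban1987RG1] (0.4) p.253, (2.9)–(2.10) pp.266–267; [Helgason2000] Ch. I §1 Thm. 1.14 p.96.
-/

noncomputable section

open scoped Matrix.Norms.L2Operator Topology ContDiff
open Filter Set Function NormedSpace

namespace Summit.QuantumFields.YangMills.Theorems.FluctuationComparisonRegPrIntLWregChartChargeOneStep

open Summit.QuantumFields.YangMills.Theorems.FluctuationComparisonRegPrIntLWregChartChargeParam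

/-! ## §4  The fibre map is JOINTLY open in (environment, W-coordinate) at every window point -/

section Fibre

open Literature.MathematicalPhysics.QuantumFieldTheory.Balaban1983to89
open Literature.MathematicalPhysics.QuantumFieldTheory.Balaban1983to89.HaarExponentialChart
open Literature.MathematicalPhysics.QuantumFieldTheory.Balaban1983to89.HaarExponentialChart.IsChartRep
open Literature.MathematicalPhysics.QuantumFieldTheory.Balaban1983to89.BlockAveraging (Small Idx avgFun loopHol continuous_holAt)
open Literature.MathematicalPhysics.QuantumFieldTheory.Balaban1983to89.BlockAveragingHaarAC (centralBond pre post openHol IsCentral)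
open Literature.MathematicalPhysics.QuantumFieldTheory.Balaban1983to89.BlockAveragingEMLHaarAC (fibreFamily fibreMap FibreSmall fibreGuard
  fibreFamily_of_isCentral fibreFamily_of_not_isCentral dist1_fibreFamily_of_not_isCentral avgFun_update_centralBond_self isOpen_fibreGuard)
open Literature.MathematicalPhysics.QuantumFieldTheory.Balaban1983to89.ExpMeanLog (eml expMeanLogSU deltaSU)
open Literature.MathematicalPhysics.QuantumFieldTheory.Balaban1983to89.MatrixLog (mlog mlog_one)
open Literature.MathematicalPhysics.QuantumFieldTheory.Balaban1983to89.Node00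
open Literature.MathematicalPhysics.QuantumLattice (fundamentalRep fundamentalRep_apply continuous_fundamentalRep)
open Summit.QuantumFields.YangMills.BalabanUVNodes.N09CentralWindowChart
  (contDiffAt_modelE contDiffAt_modelChart coe_fibreMap_eq_modelE modelChart_apply_eq_logChart fibreSmall_of_mem_window coe_expChart_SU)
open Summit.QuantumFields.YangMills.BalabanUVNodes.N09CentralWindowOpenMapping
  (map_expChart_nhds_zero map_mul_expChart_nhds_zero continuousAt_fibreMap_of_fibreSmall map_nhds_modelSlice_eq)

variable {N : ℕ} [NeZero N] {P : Params} {j : ℕ}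

/-- The environment letters `U ↦ (V_i(U))_i` (as matrices) are continuous (✓`continuous_holAt`). [cite: Balaban1987RG1, (0.4) p.253 (bookkeeping)] -/
theorem continuous_openHolFamily_coe (c : PBond P (j + 1)) :
    Continuous fun U : GaugeField P j (SU N) => (fun i => ((openHol U c i : SU N) : Matrix (Fin N) (Fin N) ℂ)) :=
  continuous_pi fun _ => continuous_subtype_val.comp (continuous_holAt _)

/-- The W-coordinate family is jointly continuous in `(U, W)`. [cite: Balaban1987RG1, (0.4) p.253 (bookkeeping)] -/
theorem continuous_fibreFamily₂ (c : PBond P (j + 1)) (i : Idx P) :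
    Continuous fun q : GaugeField P j (SU N) × SU N => fibreFamily q.1 c q.2 i := by
  by_cases hi : IsCentral c i
  · simp only [fibreFamily, if_pos hi]; exact continuous_const
  · simp only [fibreFamily, if_neg hi]
    exact ((continuous_holAt _).comp continuous_fst).mul continuous_snd.inv

/-- The joint guard `{(U, W) | FibreSmall U c W}` is open. [cite: Balaban1987RG1, (0.4) p.253 (bookkeeping)] -/
theorem isOpen_fibreGuard₂ (c : PBond P (j + 1)) :
    IsOpen {q : GaugeField P j (SU N) × SU N | FibreSmall (expMeanLogSU (n := Fin N)) q.1 c q.2} := by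
  have hset : {q : GaugeField P j (SU N) × SU N | FibreSmall (expMeanLogSU (n := Fin N)) q.1 c q.2} =
      ⋂ i, {q : GaugeField P j (SU N) × SU N | dist1 (fibreFamily q.1 c q.2 i) < (expMeanLogSU (n := Fin N)).δ} := by
    ext q; simp [FibreSmall]
  rw [hset]
  exact isOpen_iInter_of_finite fun i =>
    isOpen_lt (B12ContinuousTransportInvarianceOn.continuous_dist1_SU.comp (continuous_fibreFamily₂ c i)) continuous_const

/-- The fibre map is JOINTLY continuous at every guard point `(U, W)` (there `↑(E_U W) = Ê(V(U), ↑W)` with `Ê` jointly `C^∞`).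
[cite: Balaban1987RG1, (0.4) p.253] -/
theorem continuousAt_fibreMap₂_of_fibreSmall (c : PBond P (j + 1)) {U₀ : GaugeField P j (SU N)} {W₁ : SU N}
    (hW₁ : FibreSmall (expMeanLogSU (n := Fin N)) U₀ c W₁) :
    ContinuousAt (fun q : GaugeField P j (SU N) × SU N => fibreMap (expMeanLogSU (n := Fin N)) q.1 c q.2) (U₀, W₁) := by
  haveI : Nonempty (Fin N) := ⟨⟨0, Nat.pos_of_ne_zero (NeZero.ne N)⟩⟩
  rw [Topology.IsInducing.subtypeVal.continuousAt_iff]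
  have hsmall : ∀ i, ¬ IsCentral c i → ‖((openHol U₀ c i : SU N) : Matrix (Fin N) (Fin N) ℂ) * star (W₁ : Matrix (Fin N) (Fin N) ℂ) - 1‖ < 1 := by
    intro i hi
    have h := hW₁ i
    rw [dist1_fibreFamily_of_not_isCentral U₀ c W₁ i hi] at h
    exact h.trans (show ExpMeanLog.deltaSU (Fin N) < 1 from (min_le_left _ _).trans_lt (by norm_num))
  have hE := (contDiffAt_modelE (N := N) c (fun V A => eml (fun i : Idx P => if IsCentral c i then (1 : Matrix (Fin N) (Fin N) ℂ) else V i * star A) * A)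
    (fun _ _ => rfl) hsmall).continuousAt
  have hinner : ContinuousAt (fun q : GaugeField P j (SU N) × SU N =>
      (((fun i => ((openHol q.1 c i : SU N) : Matrix (Fin N) (Fin N) ℂ)), (q.2 : Matrix (Fin N) (Fin N) ℂ)) :
        (Idx P → Matrix (Fin N) (Fin N) ℂ) × Matrix (Fin N) (Fin N) ℂ)) (U₀, W₁) :=
    (((continuous_openHolFamily_coe c).comp continuous_fst).prodMk (continuous_subtype_val.comp continuous_snd)).continuousAt
  have hcomp := ContinuousAt.comp_of_eq hE hinner rfl
  refine hcomp.congr ?_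
  filter_upwards [(isOpen_fibreGuard₂ (N := N) c).mem_nhds (show (U₀, W₁) ∈ {q : GaugeField P j (SU N) × SU N |
      FibreSmall (expMeanLogSU (n := Fin N)) q.1 c q.2} from hW₁)] with q hq
  simp only [Function.comp_apply]
  exact (coe_fibreMap_eq_modelE q.1 c _ (fun _ _ => rfl) hq).symm

/-- The fibre map at a FIXED W-coordinate is continuous in the environment at every guard point. [cite: Balaban1987RG1, (0.4) p.253] -/
theorem continuousAt_fibreMap_env_of_fibreSmall (c : PBond P (j + 1)) {U₀ : GaugeField P j (SU N)} {W₁ : SU N}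
    (hW₁ : FibreSmall (expMeanLogSU (n := Fin N)) U₀ c W₁) :
    ContinuousAt (fun U : GaugeField P j (SU N) => fibreMap (expMeanLogSU (n := Fin N)) U c W₁) U₀ := by
  haveI : Nonempty (Fin N) := ⟨⟨0, Nat.pos_of_ne_zero (NeZero.ne N)⟩⟩
  rw [Topology.IsInducing.subtypeVal.continuousAt_iff]
  have hsmall : ∀ i, ¬ IsCentral c i → ‖((openHol U₀ c i : SU N) : Matrix (Fin N) (Fin N) ℂ) * star (W₁ : Matrix (Fin N) (Fin N) ℂ) - 1‖ < 1 := by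
    intro i hi
    have h := hW₁ i
    rw [dist1_fibreFamily_of_not_isCentral U₀ c W₁ i hi] at h
    exact h.trans (show ExpMeanLog.deltaSU (Fin N) < 1 from (min_le_left _ _).trans_lt (by norm_num))
  have hE := (contDiffAt_modelE (N := N) c (fun V A => eml (fun i : Idx P => if IsCentral c i then (1 : Matrix (Fin N) (Fin N) ℂ) else V i * star A) * A)
    (fun _ _ => rfl) hsmall).continuousAt
  have hinner : ContinuousAt (fun U : GaugeField P j (SU N) =>
      (((fun i => ((openHol U c i : SU N) : Matrix (Fin N) (Fin N) ℂ)), (W₁ : Matrix (Fin N) (Fin N) ℂ)) :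
        (Idx P → Matrix (Fin N) (Fin N) ℂ) × Matrix (Fin N) (Fin N) ℂ)) U₀ :=
    ((continuous_openHolFamily_coe c).prodMk continuous_const).continuousAt
  have hcomp := ContinuousAt.comp_of_eq hE hinner rfl
  refine hcomp.congr ?_
  have hG : {U : GaugeField P j (SU N) | FibreSmall (expMeanLogSU (n := Fin N)) U c W₁} ∈ 𝓝 U₀ :=
    ((isOpen_fibreGuard₂ (N := N) c).preimage (continuous_id.prodMk continuous_const)).mem_nhds hW₁
  filter_upwards [hG] with U hU
  simp only [Function.comp_apply]
  exact (coe_fibreMap_eq_modelE U c _ (fun _ _ => rfl) hU).symm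

/-- **Near `(U₀, 0)` the fibre map reads through the chart model, jointly**: `E_U(W₁·Θ X) = E_U(W₁)·Θ(Φ((V(U),↑W₁), X))` eventually as `(U, X) → (U₀, 0)`.
[cite: Balaban1987RG1, (0.4) p.253 and (2.10) p.267; Helgason2000, Ch. I §1 Thm. 1.14 (13) p. 96] -/
theorem eventually_fibreMap_mul_expChart_eq₂ (c : PBond P (j + 1)) {α : ℝ} (hαδ : α < deltaSU (Fin N))
    (Φ : ((Idx P → Matrix (Fin N) (Fin N) ℂ) × Matrix (Fin N) (Fin N) ℂ) × (specialUnitaryLogChart (Fin N)).lie → (specialUnitaryLogChart (Fin N)).lie)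
    (hΦ : ∀ p, Φ p = HaarExpChartLocal.proj (specialUnitaryLogChart (Fin N))
      (mlog (star ((fun V A => eml (fun i : Idx P => if IsCentral c i then (1 : Matrix (Fin N) (Fin N) ℂ) else V i * star A) * A) p.1.1 p.1.2) *
        (fun V A => eml (fun i : Idx P => if IsCentral c i then (1 : Matrix (Fin N) (Fin N) ℂ) else V i * star A) * A) p.1.1
          (p.1.2 * exp ((p.2 : (specialUnitaryLogChart (Fin N)).lie) : Matrix (Fin N) (Fin N) ℂ)))))
    {U₀ : GaugeField P j (SU N)} {W₁ : SU N} (hW₁ : ∀ i : Idx P, dist1 (fibreFamily U₀ c W₁ i) ≤ α) :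
    ∀ᶠ q : GaugeField P j (SU N) × (specialUnitaryLogChart (Fin N)).lie in 𝓝 (U₀, 0),
      fibreMap (expMeanLogSU (n := Fin N)) q.1 c (W₁ * (isChartRep_specialUnitaryGroup (n := Fin N)).expChart q.2) =
        fibreMap (expMeanLogSU (n := Fin N)) q.1 c W₁ *
          (isChartRep_specialUnitaryGroup (n := Fin N)).expChart
            (Φ ((fun i => ((openHol q.1 c i : SU N) : Matrix (Fin N) (Fin N) ℂ), (W₁ : Matrix (Fin N) (Fin N) ℂ)), q.2)) := by
  have hfs : FibreSmall (expMeanLogSU (n := Fin N)) U₀ c W₁ := fibreSmall_of_mem_window U₀ c hαδ hW₁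
  -- `(U, W₁·Θ X) → (U₀, W₁)` and `(U, W₁) → (U₀, W₁)`; both stay in the (open) joint guard
  have hcurve : Tendsto (fun q : GaugeField P j (SU N) × (specialUnitaryLogChart (Fin N)).lie =>
      (q.1, W₁ * (isChartRep_specialUnitaryGroup (n := Fin N)).expChart q.2)) (𝓝 (U₀, 0)) (𝓝 (U₀, W₁)) :=
    (map_nhds_param_mul_expChart (N := N) (m := fun _ : GaugeField P j (SU N) => W₁) continuousAt_const).le
  have hbase : Tendsto (fun q : GaugeField P j (SU N) × (specialUnitaryLogChart (Fin N)).lie => (q.1, W₁)) (𝓝 (U₀, 0)) (𝓝 (U₀, W₁)) :=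
    ((continuous_fst (X := GaugeField P j (SU N)) (Y := (specialUnitaryLogChart (Fin N)).lie)).prodMk
      (continuous_const (y := W₁))).continuousAt
  have hG := (isOpen_fibreGuard₂ (N := N) c).mem_nhds
    (show (U₀, W₁) ∈ {q : GaugeField P j (SU N) × SU N | FibreSmall (expMeanLogSU (n := Fin N)) q.1 c q.2} from hfs)
  have hguard : ∀ᶠ q : GaugeField P j (SU N) × (specialUnitaryLogChart (Fin N)).lie in 𝓝 (U₀, 0),
      FibreSmall (expMeanLogSU (n := Fin N)) q.1 c (W₁ * (isChartRep_specialUnitaryGroup (n := Fin N)).expChart q.2) :=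
    hcurve.eventually_mem hG
  have hguard₁ : ∀ᶠ q : GaugeField P j (SU N) × (specialUnitaryLogChart (Fin N)).lie in 𝓝 (U₀, 0),
      FibreSmall (expMeanLogSU (n := Fin N)) q.1 c W₁ :=
    hbase.eventually_mem hG
  -- the quotient `E_U(W₁)⁻¹·E_U(W₁ Θ X) → 1`
  have hE := continuousAt_fibreMap₂_of_fibreSmall (N := N) c hfs
  have hquot : Tendsto (fun q : GaugeField P j (SU N) × (specialUnitaryLogChart (Fin N)).lie =>
      (fibreMap (expMeanLogSU (n := Fin N)) q.1 c W₁)⁻¹ *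
        fibreMap (expMeanLogSU (n := Fin N)) q.1 c (W₁ * (isChartRep_specialUnitaryGroup (n := Fin N)).expChart q.2)) (𝓝 (U₀, 0)) (𝓝 1) := by
    have h := ((hE.tendsto.comp hbase).inv).mul (hE.tendsto.comp hcurve)
    rwa [inv_mul_cancel] at h
  have hnorm : ∀ᶠ q : GaugeField P j (SU N) × (specialUnitaryLogChart (Fin N)).lie in 𝓝 (U₀, 0),
      ‖fundamentalRep (Fin N) ((fibreMap (expMeanLogSU (n := Fin N)) q.1 c W₁)⁻¹ *
          fibreMap (expMeanLogSU (n := Fin N)) q.1 c (W₁ * (isChartRep_specialUnitaryGroup (n := Fin N)).expChart q.2)) - 1‖ <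
        innerRadius (specialUnitaryLogChart (Fin N)) := by
    have hc : Tendsto (fun q : GaugeField P j (SU N) × (specialUnitaryLogChart (Fin N)).lie =>
        ‖fundamentalRep (Fin N) ((fibreMap (expMeanLogSU (n := Fin N)) q.1 c W₁)⁻¹ *
          fibreMap (expMeanLogSU (n := Fin N)) q.1 c (W₁ * (isChartRep_specialUnitaryGroup (n := Fin N)).expChart q.2)) - 1‖) (𝓝 (U₀, 0)) (𝓝 0) := by
      have h := ((continuous_fundamentalRep (Fin N)).tendsto (1 : SU N)).comp hquot
      rw [map_one] at h
      have h' := (h.sub_const (1 : Matrix (Fin N) (Fin N) ℂ)).norm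
      rwa [sub_self, norm_zero] at h'
    exact hc.eventually (gt_mem_nhds innerRadius_pos)
  filter_upwards [hguard, hguard₁, hnorm] with q hX hb hk
  have hk' : ‖((((fibreMap (expMeanLogSU (n := Fin N)) q.1 c W₁)⁻¹ *
      fibreMap (expMeanLogSU (n := Fin N)) q.1 c (W₁ * (isChartRep_specialUnitaryGroup (n := Fin N)).expChart q.2) : SU N) : Matrix (Fin N) (Fin N) ℂ)) - 1‖ <
        innerRadius (specialUnitaryLogChart (Fin N)) := by
    rwa [fundamentalRep_apply] at hk
  rw [modelChart_apply_eq_logChart q.1 c _ (fun _ _ => rfl) Φ hΦ hb hX hk', (isChartRep_specialUnitaryGroup (n := Fin N)).expChart_logChart hk,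
    mul_inv_cancel_left]

/-- ★★★ **THE FIBRE MAP IS JOINTLY OPEN AT EVERY WINDOW POINT**: `(U, W) ↦ (U, E_U(W))` maps `𝓝 (U₀, W₁)` onto `𝓝 (U₀, E_{U₀}(W₁))` whenever
`dist1 (fibreFamily U₀ c W₁ i) ≤ α` for all `i` (`j+1 ≤ m+K`, `α ≤ 1∕24`, `α < δ_N`, `157·α < L^{−(d−1)}`) — the parameter-carrying edition of
✓`map_nhds_fibreMap_eq_of_mem_centralWindow`. [cite: Balaban1985Averaging, Prop. 3 (124) p.36; Balaban1987RG1, (0.4) p.253 and (2.10) p.267] -/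
theorem map_nhds_fibreMap₂_eq_of_mem_centralWindow (hj : j + 1 ≤ P.m + P.K) (c : PBond P (j + 1)) {α : ℝ}
    (hα24 : α ≤ 1 / 24) (hαδ : α < deltaSU (Fin N)) (hαL : 157 * α < ((P.L : ℝ) ^ (P.d - 1))⁻¹)
    {U₀ : GaugeField P j (SU N)} {W₁ : SU N} (hW₁ : ∀ i : Idx P, dist1 (fibreFamily U₀ c W₁ i) ≤ α) :
    map (fun q : GaugeField P j (SU N) × SU N => (q.1, fibreMap (expMeanLogSU (n := Fin N)) q.1 c q.2)) (𝓝 (U₀, W₁)) =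
      𝓝 (U₀, fibreMap (expMeanLogSU (n := Fin N)) U₀ c W₁) := by
  -- the chart model, introduced by its defining equation
  obtain ⟨Φ, hΦ⟩ : ∃ Φ : ((Idx P → Matrix (Fin N) (Fin N) ℂ) × Matrix (Fin N) (Fin N) ℂ) × (specialUnitaryLogChart (Fin N)).lie → (specialUnitaryLogChart (Fin N)).lie,
      ∀ p, Φ p = HaarExpChartLocal.proj (specialUnitaryLogChart (Fin N))
        (mlog (star ((fun V A => eml (fun i : Idx P => if IsCentral c i then (1 : Matrix (Fin N) (Fin N) ℂ) else V i * star A) * A) p.1.1 p.1.2) *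
          (fun V A => eml (fun i : Idx P => if IsCentral c i then (1 : Matrix (Fin N) (Fin N) ℂ) else V i * star A) * A) p.1.1
            (p.1.2 * exp ((p.2 : (specialUnitaryLogChart (Fin N)).lie) : Matrix (Fin N) (Fin N) ℂ)))) := ⟨_, fun _ => rfl⟩
  have hfs : FibreSmall (expMeanLogSU (n := Fin N)) U₀ c W₁ := fibreSmall_of_mem_window U₀ c hαδ hW₁
  -- `ψ 0 = 0` at `U₀` (✓`map_nhds_modelSlice_eq` gives the slice; we only need the value)
  have hψ0 : Φ ((fun i => ((openHol U₀ c i : SU N) : Matrix (Fin N) (Fin N) ℂ), (W₁ : Matrix (Fin N) (Fin N) ℂ)), 0) = 0 := by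
    have hX : FibreSmall (expMeanLogSU (n := Fin N)) U₀ c (W₁ * (isChartRep_specialUnitaryGroup (n := Fin N)).expChart 0) := by
      rw [IsChartRep.expChart_zero, mul_one]; exact hfs
    have hk : ‖((((fibreMap (expMeanLogSU (n := Fin N)) U₀ c W₁)⁻¹ *
        fibreMap (expMeanLogSU (n := Fin N)) U₀ c (W₁ * (isChartRep_specialUnitaryGroup (n := Fin N)).expChart 0) : SU N) : Matrix (Fin N) (Fin N) ℂ)) - 1‖ <
          innerRadius (specialUnitaryLogChart (Fin N)) := by
      rw [IsChartRep.expChart_zero, mul_one, inv_mul_cancel, OneMemClass.coe_one, sub_self, norm_zero]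
      exact innerRadius_pos
    rw [modelChart_apply_eq_logChart U₀ c _ (fun _ _ => rfl) Φ hΦ hfs hX hk, IsChartRep.expChart_zero, mul_one, inv_mul_cancel,
      (isChartRep_specialUnitaryGroup (n := Fin N)).logChart_one]
  -- (K) the model step, pulled back along the continuous letters `U ↦ (V(U), ↑W₁)`
  have hA : ContinuousAt (fun U : GaugeField P j (SU N) =>
      (((fun i => ((openHol U c i : SU N) : Matrix (Fin N) (Fin N) ℂ)), (W₁ : Matrix (Fin N) (Fin N) ℂ)) :
        (Idx P → Matrix (Fin N) (Fin N) ℂ) × Matrix (Fin N) (Fin N) ℂ)) U₀ :=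
    ((continuous_openHolFamily_coe c).prodMk continuous_const).continuousAt
  have hK : map (fun q : GaugeField P j (SU N) × (specialUnitaryLogChart (Fin N)).lie =>
      (q.1, Φ ((fun i => ((openHol q.1 c i : SU N) : Matrix (Fin N) (Fin N) ℂ), (W₁ : Matrix (Fin N) (Fin N) ℂ)), q.2))) (𝓝 (U₀, 0)) = 𝓝 (U₀, 0) := by
    have h := map_nhds_param_pullback (f := fun p X => Φ (p, X)) (y₀ := (0 : (specialUnitaryLogChart (Fin N)).lie)) hA
      (map_nhds_modelJoint_eq (N := N) hj U₀ c hα24 hαδ hαL Φ hΦ hW₁)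
    rw [hψ0] at h
    exact h
  -- (H) `(U, Y) ↦ (U, E_U(W₁)·Θ Y)`
  have hm := continuousAt_fibreMap_env_of_fibreSmall (N := N) c hfs
  have hH := map_nhds_param_mul_expChart (N := N) (x₀ := U₀)
    (m := fun U : GaugeField P j (SU N) => fibreMap (expMeanLogSU (n := Fin N)) U c W₁) hm
  beta_reduce at hH
  have hident := eventually_fibreMap_mul_expChart_eq₂ (N := N) c hαδ Φ hΦ hW₁
  -- (C) the base curve `(U, X) ↦ (U, W₁·Θ X)`
  have hC := map_nhds_param_mul_expChart (N := N) (x₀ := U₀) (m := fun _ : GaugeField P j (SU N) => W₁) continuousAt_const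
  beta_reduce at hC
  -- assemble: `JF ∘ C =ᶠ H ∘ K` near `(U₀, 0)`
  have hEq : (fun q : GaugeField P j (SU N) × (specialUnitaryLogChart (Fin N)).lie =>
        (q.1, fibreMap (expMeanLogSU (n := Fin N)) q.1 c (W₁ * (isChartRep_specialUnitaryGroup (n := Fin N)).expChart q.2))) =ᶠ[𝓝 (U₀, 0)]
      (fun q : GaugeField P j (SU N) × (specialUnitaryLogChart (Fin N)).lie =>
        (q.1, fibreMap (expMeanLogSU (n := Fin N)) q.1 c W₁ * (isChartRep_specialUnitaryGroup (n := Fin N)).expChart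
          (Φ ((fun i => ((openHol q.1 c i : SU N) : Matrix (Fin N) (Fin N) ℂ), (W₁ : Matrix (Fin N) (Fin N) ℂ)), q.2)))) :=
    hident.mono fun q hq => Prod.ext rfl hq
  have hstep : map (fun q : GaugeField P j (SU N) × SU N => (q.1, fibreMap (expMeanLogSU (n := Fin N)) q.1 c q.2)) (𝓝 (U₀, W₁)) =
      map (fun q : GaugeField P j (SU N) × (specialUnitaryLogChart (Fin N)).lie =>
        (q.1, fibreMap (expMeanLogSU (n := Fin N)) q.1 c (W₁ * (isChartRep_specialUnitaryGroup (n := Fin N)).expChart q.2))) (𝓝 (U₀, 0)) := by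
    rw [← hC, Filter.map_map]; rfl
  rw [hstep, Filter.map_congr hEq]
  have hcomp : (fun q : GaugeField P j (SU N) × (specialUnitaryLogChart (Fin N)).lie =>
        (q.1, fibreMap (expMeanLogSU (n := Fin N)) q.1 c W₁ * (isChartRep_specialUnitaryGroup (n := Fin N)).expChart
          (Φ ((fun i => ((openHol q.1 c i : SU N) : Matrix (Fin N) (Fin N) ℂ), (W₁ : Matrix (Fin N) (Fin N) ℂ)), q.2)))) =
      (fun q : GaugeField P j (SU N) × (specialUnitaryLogChart (Fin N)).lie =>
        (q.1, fibreMap (expMeanLogSU (n := Fin N)) q.1 c W₁ * (isChartRep_specialUnitaryGroup (n := Fin N)).expChart q.2)) ∘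
      (fun q : GaugeField P j (SU N) × (specialUnitaryLogChart (Fin N)).lie =>
        (q.1, Φ ((fun i => ((openHol q.1 c i : SU N) : Matrix (Fin N) (Fin N) ℂ), (W₁ : Matrix (Fin N) (Fin N) ℂ)), q.2))) := rfl
  rw [hcomp, ← Filter.map_map, hK, hH]

end Fibre

/-! ## §5  The `g`-variable edition: the one-bond (0.4) average is JOINTLY open in (environment, pivot) at every window point -/

section Pivot

open Literature.MathematicalPhysics.QuantumFieldTheory.Balaban1983to89
open Literature.MathematicalPhysics.QuantumFieldTheory.Balaban1983to89.BlockAveraging (Small Idx avgFun loopHol continuous_holAt)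
open Literature.MathematicalPhysics.QuantumFieldTheory.Balaban1983to89.BlockAveragingHaarAC (centralBond pre post openHol IsCentral)
open Literature.MathematicalPhysics.QuantumFieldTheory.Balaban1983to89.BlockAveragingEMLHaarAC (fibreFamily fibreMap FibreSmall fibreGuard
  avgFun_update_centralBond_self)
open Literature.MathematicalPhysics.QuantumFieldTheory.Balaban1983to89.ExpMeanLog (expMeanLogSU deltaSU)
open Literature.MathematicalPhysics.QuantumFieldTheory.Balaban1983to89.Node00

variable {N : ℕ} [NeZero N] {P : Params} {j : ℕ}

/-- Parametric bi-translation by the half-line transporters: `(U, g) ↦ (U, pre(U)·g·post(U))` maps `𝓝 (U₀, g₀)` onto `𝓝 (U₀, pre(U₀)·g₀·post(U₀))`.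
[cite: Balaban1987RG1, (0.4) p.253 (bookkeeping)] -/
theorem map_nhds_preMulPost (c : PBond P (j + 1)) (U₀ : GaugeField P j (SU N)) (g₀ : SU N) :
    map (fun q : GaugeField P j (SU N) × SU N => (q.1, pre q.1 c * q.2 * post q.1 c)) (𝓝 (U₀, g₀)) = 𝓝 (U₀, pre U₀ c * g₀ * post U₀ c) := by
  have hR := map_nhds_param_mul_right (N := N) (x₀ := U₀) (m := fun U : GaugeField P j (SU N) => post U c) (continuous_holAt _).continuousAt g₀
  have hL := map_nhds_param_mul_left (N := N) (x₀ := U₀) (m := fun U : GaugeField P j (SU N) => pre U c) (continuous_holAt _).continuousAt (g₀ * post U₀ c)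
  beta_reduce at hR hL
  have hcomp : (fun q : GaugeField P j (SU N) × SU N => (q.1, pre q.1 c * q.2 * post q.1 c)) =
      (fun q : GaugeField P j (SU N) × SU N => (q.1, pre q.1 c * q.2)) ∘ (fun q : GaugeField P j (SU N) × SU N => (q.1, q.2 * post q.1 c)) := by
    funext q; simp [mul_assoc]
  rw [hcomp, ← Filter.map_map, hR, hL, mul_assoc]

/-- ★★★ **THE ONE-BOND (0.4) AVERAGE IS JOINTLY OPEN IN (ENVIRONMENT, PIVOT) AT EVERY CENTRAL-WINDOW POINT**: for `g₀` in the closed central `α`-window of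
`U₀` at `c` (`j+1 ≤ m+K`, `α ≤ 1∕24`, `α < δ_N`, `157·α < L^{−(d−1)}`), `(U, g) ↦ (U, Ū(U[β c ↦ g])(c))` maps `𝓝 (U₀, g₀)` onto `𝓝 (U₀, Ū(U₀[β c ↦ g₀])(c))` — so for
every environment `U` near `U₀` and every target near `Ū(U₀[β c ↦ g₀])(c)` there is a pivot `g` near `g₀` hitting it (parametric solvability; the parameter-carrying
edition of ✓`map_nhds_oneVariable_eq_of_mem_centralWindow`). [cite: Balaban1985Averaging, Prop. 3 (124) p.36; Balaban1987RG1, (0.4) p.253 and (2.10) p.267] -/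
theorem map_nhds_oneVariable₂_eq_of_mem_centralWindow (hj : j + 1 ≤ P.m + P.K) (c : PBond P (j + 1)) {α : ℝ}
    (hα24 : α ≤ 1 / 24) (hαδ : α < deltaSU (Fin N)) (hαL : 157 * α < ((P.L : ℝ) ^ (P.d - 1))⁻¹)
    {U₀ : GaugeField P j (SU N)} {g₀ : SU N} (hg₀ : ∀ i : Idx P, dist1 (fibreFamily U₀ c (pre U₀ c * g₀ * post U₀ c) i) ≤ α) :
    map (fun q : GaugeField P j (SU N) × SU N => (q.1, avgFun (expMeanLogSU (n := Fin N)) (update q.1 (centralBond c) q.2) c)) (𝓝 (U₀, g₀)) =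
      𝓝 (U₀, avgFun (expMeanLogSU (n := Fin N)) (update U₀ (centralBond c) g₀) c) := by
  have hfun : (fun q : GaugeField P j (SU N) × SU N => (q.1, avgFun (expMeanLogSU (n := Fin N)) (update q.1 (centralBond c) q.2) c)) =
      (fun q : GaugeField P j (SU N) × SU N => (q.1, fibreMap (expMeanLogSU (n := Fin N)) q.1 c q.2)) ∘
        (fun q : GaugeField P j (SU N) × SU N => (q.1, pre q.1 c * q.2 * post q.1 c)) := by
    funext q
    simp only [Function.comp_apply, avgFun_update_centralBond_self hj]
  rw [hfun, ← Filter.map_map, map_nhds_preMulPost (N := N) c U₀ g₀, map_nhds_fibreMap₂_eq_of_mem_centralWindow (N := N) hj c hα24 hαδ hαL hg₀,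
    avgFun_update_centralBond_self hj]

end Pivot

end Summit.QuantumFields.YangMills.Theorems.FluctuationComparisonRegPrIntLWregChartChargeOneStep

end
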